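import Literature.Computability.Complexity.StackMachines
import HarnessLib

/-!
# Structured stack programs: a compositional cost semantics compiled to stack machines

Trunk `CplxCore`, toolkit for `TimeBounds.lean`, continuing `StackMachines.lean`. To *write*
polynomial-time algorithms for the tree's `TM2`-based classes we use structured programs over
`K` binary stack registers,

  `Com ι ::= push k b | pop k cₜ c_f cₙ | c₁ ;; c₂ | skip | loop k cₜ c_f | halt`   (`k : ι`),

where `pop k cₜ c_f cₙ` pops register `k` and continues with `cₜ`/`c_f` according to the popped
bit (with `cₙ`, register unchanged, if it is empty), `loop k cₜ c_f` repeats "pop register `k`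
and run `cₜ`/`c_f`" until register `k` is empty (destructive iteration over the bits of a
register — the only loop construct; a loop whose body does not push on the loop register runs
once per bit, which is how all loops of the program libraries are written — in general a body
may refill its register and diverge, and then simply no `Exec` derivation exists), and `halt`
stops the whole program at once (an exception, used to emit an oracle query from inside nested
loops).

* `Com.Exec c R s R' t` — big-step semantics with an **exact cost** `t` and a stop flag `s`
  (`s = true`: a `halt` was executed; the rest of the program is skipped). It is a
  specification device: costs are those of the compiled code.
* `Com.code c base fin` — compilation to a flat stack-machine program (`StackMachines.lean`)
  placed at address `base`, `halt` jumping to `fin`; `Com.compile c = code c 0 |c|`.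
* `Com.Exec.iterate_step` — **adequacy**: an execution `Exec c R s R' t` is matched by exactly
  `t` steps of any machine program containing `code c base fin` at `base` (from `⟨base, R⟩` to
  `⟨base + |c|, R'⟩`, or to the halted `⟨fin, R'⟩` if stopped);
* `Com.outputFn_mem_FP` — hence (with `SProg.outputFn_mem_FP`): if for every input `z` the
  program started on `init z` executes with cost `≤ T(|z|)` leaving `f z` in register `out`,
  then `f ∈ FP`. This reduces membership in `FP` (and `OracleAlg.IsPolyTime`) to programming
  with cost bounds; `Runs c R R' B` (normal execution within budget `B`) and its composition
  rules are the interface used by the program libraries (`StackArith.lean`).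

This is the standard "compiler correctness for a WHILE-language onto a jump machine" argument
(Nipkow–Klein, *Concrete Semantics*, Ch. 8), with step counting added.

## References

* T. Nipkow, G. Klein, *Concrete Semantics with Isabelle/HOL*, Springer 2014, Ch. 7 (big-step
  semantics), Ch. 8 (compiler to a stack/jump machine and its correctness). (Not held; the
  construction is standard and fully proved here.)
* M. L. Minsky, *Computation: Finite and Infinite Machines*, Prentice-Hall 1967, §11.1.
-/

namespace Literature.Computability.Complexity

open _root_.Computability

/-- Register files indexed by `ι` (for the machine, `ι = Fin K`). [folklore] -/
abbrev Regs (ι : Type) : Type := ι → List Bool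

/-- The initial register file: input `z` in register `inp`, all others empty. [folklore] -/
def Regs.init {ι : Type} [DecidableEq ι] (inp : ι) (z : List Bool) : Regs ι :=
  fun i => if i = inp then z else []

/-! ### Syntax -/

/-- Structured stack programs over registers indexed by `ι` (see the module docstring).
[Nipkow–Klein 2014, Ch. 7–8; Minsky 1967, §11.1] [folklore] -/
inductive Com (ι : Type) where
  | push (k : ι) (b : Bool) : Com ι
  | pop (k : ι) (ct cf cn : Com ι) : Com ι
  | seq (c₁ c₂ : Com ι) : Com ι
  | skip : Com ι
  | loop (k : ι) (ct cf : Com ι) : Com ι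
  | halt : Com ι

namespace Com

/-- Sequential composition. -/
infixr:30 " ;; " => Com.seq

/-- Renaming the registers of a program along `f : ι → κ`. [folklore] -/
def map {ι κ : Type} (f : ι → κ) : Com ι → Com κ
  | push k b => push (f k) b
  | pop k ct cf cn => pop (f k) (ct.map f) (cf.map f) (cn.map f)
  | seq c₁ c₂ => seq (c₁.map f) (c₂.map f)
  | skip => skip
  | loop k ct cf => loop (f k) (ct.map f) (cf.map f)
  | halt => halt

section Semantics

variable {ι : Type} [DecidableEq ι]

/-! ### Big-step semantics with exact cost -/

/-- `Exec c R s R' t`: started on registers `R`, the program `c` terminates after exactly `t`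
machine steps with registers `R'`; `s = true` iff it executed `halt` (and then everything after
it is skipped). Costs: `push` 1, `skip` 0, `halt` 1, a `pop`-branch costs 2 plus its branch, a
loop exit 1, a loop iteration 2 plus its body. (For stopped executions the cost is that of the
compiled code padded with idle steps of the halted machine, so that it stays additive.)
[Nipkow–Klein 2014, §7.2 (big-step rules)] [folklore] -/
inductive Exec : Com ι → Regs ι → Bool → Regs ι → ℕ → Prop
  | push {k : ι} {b : Bool} {R : Regs ι} :
      Exec (push k b) R false (Function.update R k (b :: R k)) 1
  | pop_true {k : ι} {ct cf cn : Com ι} {R R' : Regs ι} {w : List Bool} {s : Bool} {t : ℕ}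
      (hk : R k = true :: w) (h : Exec ct (Function.update R k w) s R' t) :
      Exec (pop k ct cf cn) R s R' (t + 2)
  | pop_false {k : ι} {ct cf cn : Com ι} {R R' : Regs ι} {w : List Bool} {s : Bool} {t : ℕ}
      (hk : R k = false :: w) (h : Exec cf (Function.update R k w) s R' t) :
      Exec (pop k ct cf cn) R s R' (t + 2)
  | pop_nil {k : ι} {ct cf cn : Com ι} {R R' : Regs ι} {s : Bool} {t : ℕ}
      (hk : R k = []) (h : Exec cn R s R' t) :
      Exec (pop k ct cf cn) R s R' (t + 2)
  | seq {c₁ c₂ : Com ι} {R R₁ R₂ : Regs ι} {s : Bool} {t₁ t₂ : ℕ}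
      (h₁ : Exec c₁ R false R₁ t₁) (h₂ : Exec c₂ R₁ s R₂ t₂) :
      Exec (c₁ ;; c₂) R s R₂ (t₁ + t₂)
  | seq_stop {c₁ c₂ : Com ι} {R R₁ : Regs ι} {t₁ : ℕ}
      (h₁ : Exec c₁ R true R₁ t₁) : Exec (c₁ ;; c₂) R true R₁ t₁
  | skip {R : Regs ι} : Exec skip R false R 0
  | loop_nil {k : ι} {ct cf : Com ι} {R : Regs ι} (hk : R k = []) :
      Exec (loop k ct cf) R false R 1
  | loop_true {k : ι} {ct cf : Com ι} {R R₁ R₂ : Regs ι} {w : List Bool} {s : Bool}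
      {t₁ t₂ : ℕ} (hk : R k = true :: w) (h₁ : Exec ct (Function.update R k w) false R₁ t₁)
      (h₂ : Exec (loop k ct cf) R₁ s R₂ t₂) :
      Exec (loop k ct cf) R s R₂ (t₁ + 2 + t₂)
  | loop_true_stop {k : ι} {ct cf : Com ι} {R R₁ : Regs ι} {w : List Bool} {t₁ : ℕ}
      (hk : R k = true :: w) (h₁ : Exec ct (Function.update R k w) true R₁ t₁) :
      Exec (loop k ct cf) R true R₁ (t₁ + 2)
  | loop_false {k : ι} {ct cf : Com ι} {R R₁ R₂ : Regs ι} {w : List Bool} {s : Bool}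
      {t₁ t₂ : ℕ} (hk : R k = false :: w) (h₁ : Exec cf (Function.update R k w) false R₁ t₁)
      (h₂ : Exec (loop k ct cf) R₁ s R₂ t₂) :
      Exec (loop k ct cf) R s R₂ (t₁ + 2 + t₂)
  | loop_false_stop {k : ι} {ct cf : Com ι} {R R₁ : Regs ι} {w : List Bool} {t₁ : ℕ}
      (hk : R k = false :: w) (h₁ : Exec cf (Function.update R k w) true R₁ t₁) :
      Exec (loop k ct cf) R true R₁ (t₁ + 2)
  | halt {R : Regs ι} : Exec halt R true R 1

/-! ### Normal executions within a budget -/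

/-- `Runs c R R' B`: from `R`, the program `c` terminates normally (no `halt`) with registers
`R'` at cost at most `B`. [Nipkow–Klein 2014, §7.2] [folklore] -/
def Runs (c : Com ι) (R R' : Regs ι) (B : ℕ) : Prop :=
  ∃ t ≤ B, Exec c R false R' t

/-- `Halts c R R' B`: from `R`, the program `c` stops (executes `halt`) with registers `R'` at
cost at most `B`. [Nipkow–Klein 2014, §7.2] [folklore] -/
def Halts (c : Com ι) (R R' : Regs ι) (B : ℕ) : Prop :=
  ∃ t ≤ B, Exec c R true R' t

/-- Budgets may be increased. [folklore] -/
theorem Runs.mono {c : Com ι} {R R' : Regs ι} {B B' : ℕ} (h : Runs c R R' B) (hB : B ≤ B') :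
    Runs c R R' B' := by
  obtain ⟨t, ht, e⟩ := h; exact ⟨t, ht.trans hB, e⟩

/-- Budgets may be increased. [folklore] -/
theorem Halts.mono {c : Com ι} {R R' : Regs ι} {B B' : ℕ} (h : Halts c R R' B) (hB : B ≤ B') :
    Halts c R R' B' := by
  obtain ⟨t, ht, e⟩ := h; exact ⟨t, ht.trans hB, e⟩

/-- Rewriting the final registers. [folklore] -/
theorem Runs.congr {c : Com ι} {R R' R'' : Regs ι} {B : ℕ} (h : Runs c R R' B) (e : R' = R'') :
    Runs c R R'' B := e ▸ h

/-- Rewriting the final registers. [folklore] -/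
theorem Halts.congr {c : Com ι} {R R' R'' : Regs ι} {B : ℕ} (h : Halts c R R' B) (e : R' = R'') :
    Halts c R R'' B := e ▸ h

/-- `push`. [folklore] -/
theorem Runs.push (k : ι) (b : Bool) (R : Regs ι) :
    Runs (push k b) R (Function.update R k (b :: R k)) 1 :=
  ⟨1, le_rfl, Exec.push⟩

/-- `skip`. [folklore] -/
theorem Runs.skip (R : Regs ι) : Runs skip R R 0 := ⟨0, le_rfl, Exec.skip⟩

/-- `halt`. [folklore] -/
theorem Halts.halt (R : Regs ι) : Halts halt R R 1 := ⟨1, le_rfl, Exec.halt⟩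

/-- Sequencing of normal executions. [folklore] -/
theorem Runs.seq {c₁ c₂ : Com ι} {R R₁ R₂ : Regs ι} {B₁ B₂ : ℕ} (h₁ : Runs c₁ R R₁ B₁)
    (h₂ : Runs c₂ R₁ R₂ B₂) : Runs (c₁ ;; c₂) R R₂ (B₁ + B₂) := by
  obtain ⟨t₁, ht₁, e₁⟩ := h₁; obtain ⟨t₂, ht₂, e₂⟩ := h₂
  exact ⟨t₁ + t₂, Nat.add_le_add ht₁ ht₂, Exec.seq e₁ e₂⟩

/-- Sequencing into a stop. [folklore] -/
theorem Runs.seq_halts {c₁ c₂ : Com ι} {R R₁ R₂ : Regs ι} {B₁ B₂ : ℕ} (h₁ : Runs c₁ R R₁ B₁)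
    (h₂ : Halts c₂ R₁ R₂ B₂) : Halts (c₁ ;; c₂) R R₂ (B₁ + B₂) := by
  obtain ⟨t₁, ht₁, e₁⟩ := h₁; obtain ⟨t₂, ht₂, e₂⟩ := h₂
  exact ⟨t₁ + t₂, Nat.add_le_add ht₁ ht₂, Exec.seq e₁ e₂⟩

/-- A stop skips the rest. [folklore] -/
theorem Halts.seq {c₁ : Com ι} (c₂ : Com ι) {R R₁ : Regs ι} {B : ℕ} (h₁ : Halts c₁ R R₁ B) :
    Halts (c₁ ;; c₂) R R₁ B := by
  obtain ⟨t₁, ht₁, e₁⟩ := h₁; exact ⟨t₁, ht₁, Exec.seq_stop e₁⟩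

/-- `pop` on a `true` bit. [folklore] -/
theorem Runs.pop_true {k : ι} {ct : Com ι} (cf cn : Com ι) {R R' : Regs ι} {w : List Bool}
    {B : ℕ} (hk : R k = true :: w) (h : Runs ct (Function.update R k w) R' B) :
    Runs (pop k ct cf cn) R R' (B + 2) := by
  obtain ⟨t, ht, e⟩ := h; exact ⟨t + 2, by omega, Exec.pop_true hk e⟩

/-- `pop` on a `false` bit. [folklore] -/
theorem Runs.pop_false {k : ι} (ct : Com ι) {cf : Com ι} (cn : Com ι) {R R' : Regs ι}
    {w : List Bool} {B : ℕ} (hk : R k = false :: w) (h : Runs cf (Function.update R k w) R' B) :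
    Runs (pop k ct cf cn) R R' (B + 2) := by
  obtain ⟨t, ht, e⟩ := h; exact ⟨t + 2, by omega, Exec.pop_false hk e⟩

/-- `pop` on an empty register. [folklore] -/
theorem Runs.pop_nil {k : ι} (ct cf : Com ι) {cn : Com ι} {R R' : Regs ι} {B : ℕ}
    (hk : R k = []) (h : Runs cn R R' B) : Runs (pop k ct cf cn) R R' (B + 2) := by
  obtain ⟨t, ht, e⟩ := h; exact ⟨t + 2, by omega, Exec.pop_nil hk e⟩

/-- `pop` on a `true` bit, stopping. [folklore] -/
theorem Halts.pop_true {k : ι} {ct : Com ι} (cf cn : Com ι) {R R' : Regs ι} {w : List Bool}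
    {B : ℕ} (hk : R k = true :: w) (h : Halts ct (Function.update R k w) R' B) :
    Halts (pop k ct cf cn) R R' (B + 2) := by
  obtain ⟨t, ht, e⟩ := h; exact ⟨t + 2, by omega, Exec.pop_true hk e⟩

/-- `pop` on a `false` bit, stopping. [folklore] -/
theorem Halts.pop_false {k : ι} (ct : Com ι) {cf : Com ι} (cn : Com ι) {R R' : Regs ι}
    {w : List Bool} {B : ℕ} (hk : R k = false :: w) (h : Halts cf (Function.update R k w) R' B) :
    Halts (pop k ct cf cn) R R' (B + 2) := by
  obtain ⟨t, ht, e⟩ := h; exact ⟨t + 2, by omega, Exec.pop_false hk e⟩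

/-- `pop` on an empty register, stopping. [folklore] -/
theorem Halts.pop_nil {k : ι} (ct cf : Com ι) {cn : Com ι} {R R' : Regs ι} {B : ℕ}
    (hk : R k = []) (h : Halts cn R R' B) : Halts (pop k ct cf cn) R R' (B + 2) := by
  obtain ⟨t, ht, e⟩ := h; exact ⟨t + 2, by omega, Exec.pop_nil hk e⟩

/-- Loop exit. [folklore] -/
theorem Runs.loop_nil {k : ι} (ct cf : Com ι) {R : Regs ι} (hk : R k = []) :
    Runs (loop k ct cf) R R 1 :=
  ⟨1, le_rfl, Exec.loop_nil hk⟩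

/-- Loop iteration on a `true` bit. [folklore] -/
theorem Runs.loop_true {k : ι} {ct cf : Com ι} {R R₁ R₂ : Regs ι} {w : List Bool}
    {B₁ B₂ : ℕ} (hk : R k = true :: w) (h₁ : Runs ct (Function.update R k w) R₁ B₁)
    (h₂ : Runs (loop k ct cf) R₁ R₂ B₂) : Runs (loop k ct cf) R R₂ (B₁ + 2 + B₂) := by
  obtain ⟨t₁, ht₁, e₁⟩ := h₁; obtain ⟨t₂, ht₂, e₂⟩ := h₂
  exact ⟨t₁ + 2 + t₂, by omega, Exec.loop_true hk e₁ e₂⟩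

/-- Loop iteration on a `false` bit. [folklore] -/
theorem Runs.loop_false {k : ι} {ct cf : Com ι} {R R₁ R₂ : Regs ι} {w : List Bool}
    {B₁ B₂ : ℕ} (hk : R k = false :: w) (h₁ : Runs cf (Function.update R k w) R₁ B₁)
    (h₂ : Runs (loop k ct cf) R₁ R₂ B₂) : Runs (loop k ct cf) R R₂ (B₁ + 2 + B₂) := by
  obtain ⟨t₁, ht₁, e₁⟩ := h₁; obtain ⟨t₂, ht₂, e₂⟩ := h₂
  exact ⟨t₁ + 2 + t₂, by omega, Exec.loop_false hk e₁ e₂⟩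

/-- Loop iteration on a `true` bit, the rest stopping. [folklore] -/
theorem Runs.loop_true_halts {k : ι} {ct cf : Com ι} {R R₁ R₂ : Regs ι} {w : List Bool}
    {B₁ B₂ : ℕ} (hk : R k = true :: w) (h₁ : Runs ct (Function.update R k w) R₁ B₁)
    (h₂ : Halts (loop k ct cf) R₁ R₂ B₂) : Halts (loop k ct cf) R R₂ (B₁ + 2 + B₂) := by
  obtain ⟨t₁, ht₁, e₁⟩ := h₁; obtain ⟨t₂, ht₂, e₂⟩ := h₂
  exact ⟨t₁ + 2 + t₂, by omega, Exec.loop_true hk e₁ e₂⟩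

/-- Loop iteration on a `false` bit, the rest stopping. [folklore] -/
theorem Runs.loop_false_halts {k : ι} {ct cf : Com ι} {R R₁ R₂ : Regs ι} {w : List Bool}
    {B₁ B₂ : ℕ} (hk : R k = false :: w) (h₁ : Runs cf (Function.update R k w) R₁ B₁)
    (h₂ : Halts (loop k ct cf) R₁ R₂ B₂) : Halts (loop k ct cf) R R₂ (B₁ + 2 + B₂) := by
  obtain ⟨t₁, ht₁, e₁⟩ := h₁; obtain ⟨t₂, ht₂, e₂⟩ := h₂
  exact ⟨t₁ + 2 + t₂, by omega, Exec.loop_false hk e₁ e₂⟩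

/-- Loop body stopping on a `true` bit. [folklore] -/
theorem Halts.loop_true {k : ι} {ct : Com ι} (cf : Com ι) {R R₁ : Regs ι} {w : List Bool}
    {B₁ : ℕ} (hk : R k = true :: w) (h₁ : Halts ct (Function.update R k w) R₁ B₁) :
    Halts (loop k ct cf) R R₁ (B₁ + 2) := by
  obtain ⟨t₁, ht₁, e₁⟩ := h₁; exact ⟨t₁ + 2, by omega, Exec.loop_true_stop hk e₁⟩

/-- Loop body stopping on a `false` bit. [folklore] -/
theorem Halts.loop_false {k : ι} (ct : Com ι) {cf : Com ι} {R R₁ : Regs ι} {w : List Bool}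
    {B₁ : ℕ} (hk : R k = false :: w) (h₁ : Halts cf (Function.update R k w) R₁ B₁) :
    Halts (loop k ct cf) R R₁ (B₁ + 2) := by
  obtain ⟨t₁, ht₁, e₁⟩ := h₁; exact ⟨t₁ + 2, by omega, Exec.loop_false_stop hk e₁⟩


/-! #### Rules with the register-file bookkeeping as a side goal -/

/-- `push`, with the resulting file given up to an equation. [folklore] -/
theorem Runs.push' {k : ι} {b : Bool} {R R' : Regs ι} (hR : Function.update R k (b :: R k) = R') :
    Runs (Com.push k b) R R' 1 := hR ▸ Runs.push k b R

/-- `pop` on `true`, with the popped file given up to an equation. [folklore] -/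
theorem Runs.pop_true' {k : ι} {ct : Com ι} (cf cn : Com ι) {R R₀ R' : Regs ι} {w : List Bool}
    {B : ℕ} (hk : R k = true :: w) (hR : Function.update R k w = R₀) (h : Runs ct R₀ R' B) :
    Runs (pop k ct cf cn) R R' (B + 2) := Runs.pop_true cf cn hk (hR ▸ h)

/-- `pop` on `false`, with the popped file given up to an equation. [folklore] -/
theorem Runs.pop_false' {k : ι} (ct : Com ι) {cf : Com ι} (cn : Com ι) {R R₀ R' : Regs ι}
    {w : List Bool} {B : ℕ} (hk : R k = false :: w) (hR : Function.update R k w = R₀)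
    (h : Runs cf R₀ R' B) : Runs (pop k ct cf cn) R R' (B + 2) := Runs.pop_false ct cn hk (hR ▸ h)

/-- `pop` on `true`, stopping, with the popped file given up to an equation. [folklore] -/
theorem Halts.pop_true' {k : ι} {ct : Com ι} (cf cn : Com ι) {R R₀ R' : Regs ι} {w : List Bool}
    {B : ℕ} (hk : R k = true :: w) (hR : Function.update R k w = R₀) (h : Halts ct R₀ R' B) :
    Halts (pop k ct cf cn) R R' (B + 2) := Halts.pop_true cf cn hk (hR ▸ h)

/-- `pop` on `false`, stopping, with the popped file given up to an equation. [folklore] -/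
theorem Halts.pop_false' {k : ι} (ct : Com ι) {cf : Com ι} (cn : Com ι) {R R₀ R' : Regs ι}
    {w : List Bool} {B : ℕ} (hk : R k = false :: w) (hR : Function.update R k w = R₀)
    (h : Halts cf R₀ R' B) : Halts (pop k ct cf cn) R R' (B + 2) := Halts.pop_false ct cn hk (hR ▸ h)

/-- Loop iteration on `true`, with the popped file given up to an equation. [folklore] -/
theorem Runs.loop_true' {k : ι} {ct cf : Com ι} {R R₀ R₁ R₂ : Regs ι} {w : List Bool} {B₁ B₂ : ℕ}
    (hk : R k = true :: w) (hR : Function.update R k w = R₀) (h₁ : Runs ct R₀ R₁ B₁)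
    (h₂ : Runs (loop k ct cf) R₁ R₂ B₂) : Runs (loop k ct cf) R R₂ (B₁ + 2 + B₂) :=
  Runs.loop_true hk (hR ▸ h₁) h₂

/-- Loop iteration on `false`, with the popped file given up to an equation. [folklore] -/
theorem Runs.loop_false' {k : ι} {ct cf : Com ι} {R R₀ R₁ R₂ : Regs ι} {w : List Bool} {B₁ B₂ : ℕ}
    (hk : R k = false :: w) (hR : Function.update R k w = R₀) (h₁ : Runs cf R₀ R₁ B₁)
    (h₂ : Runs (loop k ct cf) R₁ R₂ B₂) : Runs (loop k ct cf) R R₂ (B₁ + 2 + B₂) :=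
  Runs.loop_false hk (hR ▸ h₁) h₂

/-- Loop iteration on `true`, the rest stopping, with an equation. [folklore] -/
theorem Runs.loop_true_halts' {k : ι} {ct cf : Com ι} {R R₀ R₁ R₂ : Regs ι} {w : List Bool}
    {B₁ B₂ : ℕ} (hk : R k = true :: w) (hR : Function.update R k w = R₀) (h₁ : Runs ct R₀ R₁ B₁)
    (h₂ : Halts (loop k ct cf) R₁ R₂ B₂) : Halts (loop k ct cf) R R₂ (B₁ + 2 + B₂) :=
  Runs.loop_true_halts hk (hR ▸ h₁) h₂

/-- Loop iteration on `false`, the rest stopping, with an equation. [folklore] -/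
theorem Runs.loop_false_halts' {k : ι} {ct cf : Com ι} {R R₀ R₁ R₂ : Regs ι} {w : List Bool}
    {B₁ B₂ : ℕ} (hk : R k = false :: w) (hR : Function.update R k w = R₀) (h₁ : Runs cf R₀ R₁ B₁)
    (h₂ : Halts (loop k ct cf) R₁ R₂ B₂) : Halts (loop k ct cf) R R₂ (B₁ + 2 + B₂) :=
  Runs.loop_false_halts hk (hR ▸ h₁) h₂

/-- Loop body stopping on `true`, with an equation. [folklore] -/
theorem Halts.loop_true' {k : ι} {ct : Com ι} (cf : Com ι) {R R₀ R₁ : Regs ι} {w : List Bool}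
    {B₁ : ℕ} (hk : R k = true :: w) (hR : Function.update R k w = R₀) (h₁ : Halts ct R₀ R₁ B₁) :
    Halts (loop k ct cf) R R₁ (B₁ + 2) := Halts.loop_true cf hk (hR ▸ h₁)

/-- Loop body stopping on `false`, with an equation. [folklore] -/
theorem Halts.loop_false' {k : ι} (ct : Com ι) {cf : Com ι} {R R₀ R₁ : Regs ι} {w : List Bool}
    {B₁ : ℕ} (hk : R k = false :: w) (hR : Function.update R k w = R₀) (h₁ : Halts cf R₀ R₁ B₁) :
    Halts (loop k ct cf) R R₁ (B₁ + 2) := Halts.loop_false ct hk (hR ▸ h₁)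

/-! ### Renaming registers -/

/-- Grafting a register file `R'` on `ι` into `S` on `κ` along `f`: registers in the range of
`f` are read from `R'`, the others from `S`. This is Mathlib's `Function.extend f R' S`, named
for its role here. [folklore] -/
noncomputable abbrev graft {κ : Type} (S : Regs κ) (f : ι → κ) (R' : Regs ι) : Regs κ := Function.extend f R' S

omit [DecidableEq ι] in
/-- Grafted values on the range (`Function.Injective.extend_apply`). [folklore] -/
theorem graft_apply {κ : Type} (S : Regs κ) {f : ι → κ} (hf : Function.Injective f) (R' : Regs ι)
    (i : ι) : graft S f R' (f i) = R' i :=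
  hf.extend_apply R' S i

omit [DecidableEq ι] in
/-- Grafted values off the range (`Function.extend_apply'`). [folklore] -/
theorem graft_of_not {κ : Type} (S : Regs κ) (f : ι → κ) (R' : Regs ι) {k : κ}
    (hk : ∀ i, f i ≠ k) : graft S f R' k = S k :=
  Function.extend_apply' R' S k fun ⟨i, hi⟩ => hk i hi

omit [DecidableEq ι] in
/-- Grafting twice along the same map keeps the last graft. [folklore] -/
theorem graft_graft {κ : Type} (S : Regs κ) {f : ι → κ} (hf : Function.Injective f)
    (R₁ R₂ : Regs ι) : graft (graft S f R₁) f R₂ = graft S f R₂ := by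
  funext k
  by_cases h : ∃ j, f j = k
  · obtain ⟨j, rfl⟩ := h; rw [graft_apply _ hf, graft_apply _ hf]
  · have hk : ∀ j, f j ≠ k := fun j hj => h ⟨j, hj⟩
    rw [graft_of_not _ _ _ hk, graft_of_not _ _ _ hk, graft_of_not _ _ _ hk]

omit [DecidableEq ι] in
/-- Grafting after an update inside the range. [folklore] -/
theorem graft_update {κ : Type} [DecidableEq κ] (S : Regs κ) {f : ι → κ} (hf : Function.Injective f)
    (R' : Regs ι) (i : ι) (v : List Bool) :
    graft (Function.update S (f i) v) f R' = graft S f R' := by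
  funext k
  by_cases h : ∃ j, f j = k
  · obtain ⟨j, rfl⟩ := h; rw [graft_apply S hf, graft_apply _ hf]
  · have hk : ∀ j, f j ≠ k := fun j hj => h ⟨j, hj⟩
    rw [graft_of_not _ _ _ hk, graft_of_not _ _ _ hk, Function.update_of_ne]
    exact fun e => hk i e.symm

omit [DecidableEq ι] in
/-- Grafting the file one reads from changes nothing. [folklore] -/
theorem graft_self {κ : Type} (S : Regs κ) {f : ι → κ} (hf : Function.Injective f) (R : Regs ι)
    (hS : ∀ i, S (f i) = R i) : graft S f R = S := by
  funext k
  by_cases h : ∃ j, f j = k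
  · obtain ⟨j, rfl⟩ := h; rw [graft_apply S hf, hS]
  · exact graft_of_not _ _ _ fun j hj => h ⟨j, hj⟩

/-- An update read through `f`. [folklore] -/
theorem update_apply_map {κ : Type} [DecidableEq κ] (S : Regs κ) {f : ι → κ}
    (hf : Function.Injective f) (R : Regs ι) (hS : ∀ i, S (f i) = R i) (k : ι) (v : List Bool)
    (i : ι) : Function.update S (f k) v (f i) = Function.update R k v i := by
  by_cases h : i = k
  · subst h; simp
  · rw [Function.update_of_ne (hf.ne h), Function.update_of_ne h, hS]

/-- Grafting an updated file is updating the graft. [folklore] -/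
theorem graft_update_eq {κ : Type} [DecidableEq κ] (S : Regs κ) {f : ι → κ}
    (hf : Function.Injective f) (R : Regs ι) (k : ι) (v : List Bool) :
    graft S f (Function.update R k v) = Function.update (graft S f R) (f k) v := by
  funext x
  by_cases h : ∃ j, f j = x
  · obtain ⟨j, rfl⟩ := h
    rw [graft_apply S hf]
    by_cases hj : j = k
    · subst hj; simp
    · rw [Function.update_of_ne hj, Function.update_of_ne (hf.ne hj), graft_apply S hf]
  · have hk : ∀ j, f j ≠ x := fun j hj => h ⟨j, hj⟩
    rw [graft_of_not _ _ _ hk, Function.update_of_ne (hk k).symm, graft_of_not _ _ _ hk]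

/-- **Executions are preserved by injective renaming of registers**, the registers outside the
range being untouched. [folklore] -/
theorem Exec.map {κ : Type} [DecidableEq κ] {f : ι → κ} (hf : Function.Injective f) {c : Com ι}
    {R : Regs ι} {s : Bool} {R' : Regs ι} {t : ℕ} (h : Exec c R s R' t) :
    ∀ (S : Regs κ), (∀ i, S (f i) = R i) → Exec (c.map f) S s (graft S f R') t := by
  induction h with
  | @push k b R =>
    intro S hS
    have e : graft S f (Function.update R k (b :: R k)) = Function.update S (f k) (b :: S (f k)) := by
      rw [graft_update_eq S hf, graft_self S hf R hS, hS]
    rw [Com.map, e]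
    exact Exec.push
  | pop_true hk h ih =>
    intro S hS
    rw [Com.map]
    refine Exec.pop_true (by rw [hS, hk]) ?_
    have := ih _ (update_apply_map S hf _ hS _ _)
    rwa [graft_update S hf] at this
  | pop_false hk h ih =>
    intro S hS
    rw [Com.map]
    refine Exec.pop_false (by rw [hS, hk]) ?_
    have := ih _ (update_apply_map S hf _ hS _ _)
    rwa [graft_update S hf] at this
  | pop_nil hk h ih =>
    intro S hS
    rw [Com.map]
    exact Exec.pop_nil (by rw [hS, hk]) (ih S hS)
  | @seq c₁ c₂ R R₁ R₂ s t₁ t₂ h₁ h₂ ih₁ ih₂ =>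
    intro S hS
    rw [Com.map]
    refine Exec.seq (ih₁ S hS) ?_
    have := ih₂ (graft S f R₁) (fun i => graft_apply S hf R₁ i)
    rwa [graft_graft S hf] at this
  | seq_stop h₁ ih₁ => intro S hS; rw [Com.map]; exact Exec.seq_stop (ih₁ S hS)
  | @skip R => intro S hS; rw [Com.map, graft_self S hf R hS]; exact Exec.skip
  | @loop_nil k ct cf R hk => intro S hS; rw [Com.map, graft_self S hf R hS]; exact Exec.loop_nil (by rw [hS, hk])
  | @loop_true k ct cf R R₁ R₂ w s t₁ t₂ hk h₁ h₂ ih₁ ih₂ =>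
    intro S hS
    rw [Com.map]
    have e₁ := ih₁ _ (update_apply_map S hf _ hS k w)
    rw [graft_update S hf] at e₁
    have e₂ := ih₂ (graft S f R₁) (fun i => graft_apply S hf R₁ i)
    rw [Com.map, graft_graft S hf] at e₂
    exact Exec.loop_true (by rw [hS, hk]) e₁ e₂
  | loop_true_stop hk h₁ ih₁ =>
    intro S hS
    rw [Com.map]
    have e₁ := ih₁ _ (update_apply_map S hf _ hS _ _)
    rw [graft_update S hf] at e₁
    exact Exec.loop_true_stop (by rw [hS, hk]) e₁
  | @loop_false k ct cf R R₁ R₂ w s t₁ t₂ hk h₁ h₂ ih₁ ih₂ =>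
    intro S hS
    rw [Com.map]
    have e₁ := ih₁ _ (update_apply_map S hf _ hS k w)
    rw [graft_update S hf] at e₁
    have e₂ := ih₂ (graft S f R₁) (fun i => graft_apply S hf R₁ i)
    rw [Com.map, graft_graft S hf] at e₂
    exact Exec.loop_false (by rw [hS, hk]) e₁ e₂
  | loop_false_stop hk h₁ ih₁ =>
    intro S hS
    rw [Com.map]
    have e₁ := ih₁ _ (update_apply_map S hf _ hS _ _)
    rw [graft_update S hf] at e₁
    exact Exec.loop_false_stop (by rw [hS, hk]) e₁
  | @halt R => intro S hS; rw [Com.map, graft_self S hf R hS]; exact Exec.halt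

/-- Renaming along an equivalence. [folklore] -/
theorem Exec.map_equiv {κ : Type} [DecidableEq κ] (e : ι ≃ κ) {c : Com ι} {R : Regs ι} {s : Bool}
    {R' : Regs ι} {t : ℕ} (h : Exec c R s R' t) :
    Exec (c.map e) (R ∘ e.symm) s (R' ∘ e.symm) t := by
  have H := h.map e.injective (R ∘ e.symm) (fun i => by simp)
  have hg : graft (R ∘ e.symm) e R' = R' ∘ e.symm := by
    funext k
    have := graft_apply (R ∘ e.symm) e.injective R' (e.symm k)
    simp only [Equiv.apply_symm_apply] at this
    rw [this, Function.comp_apply]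
  rwa [hg] at H

omit [DecidableEq ι] in
/-- Grafting into `Sum.elim R T` along `Sum.inl` replaces the left file. [folklore] -/
theorem graft_inl {κ : Type} (R R' : Regs ι) (T : Regs κ) :
    graft (Sum.elim R T) Sum.inl R' = Sum.elim R' T := by
  funext k
  cases k with
  | inl i => exact graft_apply _ Sum.inl_injective _ i
  | inr j => rw [graft_of_not _ _ _ (fun i => Sum.inl_ne_inr)]; rfl

omit [DecidableEq ι] in
/-- Grafting into `Sum.elim T R` along `Sum.inr` replaces the right file. [folklore] -/
theorem graft_inr {κ : Type} (T : Regs κ) (R R' : Regs ι) :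
    graft (Sum.elim T R) Sum.inr R' = Sum.elim T R' := by
  funext k
  cases k with
  | inr i => exact graft_apply _ Sum.inr_injective _ i
  | inl j => rw [graft_of_not _ _ _ (fun i => Sum.inr_ne_inl)]; rfl

/-- **A program on the left registers of a sum runs there, leaving the right registers alone.**
[folklore] -/
theorem Exec.inl {κ : Type} [DecidableEq κ] {c : Com ι} {R : Regs ι} {s : Bool} {R' : Regs ι}
    {t : ℕ} (h : Exec c R s R' t) (T : Regs κ) :
    Exec (c.map Sum.inl) (Sum.elim R T) s (Sum.elim R' T) t := by
  have H := h.map Sum.inl_injective (Sum.elim R T) (fun _ => rfl)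
  rwa [graft_inl] at H

/-- **A program on the right registers of a sum runs there, leaving the left registers alone.**
[folklore] -/
theorem Exec.inr {κ : Type} [DecidableEq κ] {c : Com ι} {R : Regs ι} {s : Bool} {R' : Regs ι}
    {t : ℕ} (h : Exec c R s R' t) (T : Regs κ) :
    Exec (c.map Sum.inr) (Sum.elim T R) s (Sum.elim T R') t := by
  have H := h.map Sum.inr_injective (Sum.elim T R) (fun _ => rfl)
  rwa [graft_inr] at H

/-- `Runs` on the left of a sum. [folklore] -/
theorem Runs.inl {κ : Type} [DecidableEq κ] {c : Com ι} {R R' : Regs ι} {B : ℕ}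
    (h : Runs c R R' B) (T : Regs κ) : Runs (c.map Sum.inl) (Sum.elim R T) (Sum.elim R' T) B := by
  obtain ⟨t, ht, e⟩ := h; exact ⟨t, ht, e.inl T⟩

/-- `Runs` on the right of a sum. [folklore] -/
theorem Runs.inr {κ : Type} [DecidableEq κ] {c : Com ι} {R R' : Regs ι} {B : ℕ}
    (h : Runs c R R' B) (T : Regs κ) : Runs (c.map Sum.inr) (Sum.elim T R) (Sum.elim T R') B := by
  obtain ⟨t, ht, e⟩ := h; exact ⟨t, ht, e.inr T⟩

/-- `Halts` on the left of a sum. [folklore] -/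
theorem Halts.inl {κ : Type} [DecidableEq κ] {c : Com ι} {R R' : Regs ι} {B : ℕ}
    (h : Halts c R R' B) (T : Regs κ) : Halts (c.map Sum.inl) (Sum.elim R T) (Sum.elim R' T) B := by
  obtain ⟨t, ht, e⟩ := h; exact ⟨t, ht, e.inl T⟩

/-- `Halts` on the right of a sum. [folklore] -/
theorem Halts.inr {κ : Type} [DecidableEq κ] {c : Com ι} {R R' : Regs ι} {B : ℕ}
    (h : Halts c R R' B) (T : Regs κ) : Halts (c.map Sum.inr) (Sum.elim T R) (Sum.elim T R') B := by
  obtain ⟨t, ht, e⟩ := h; exact ⟨t, ht, e.inr T⟩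

end Semantics

/-! ### Compilation to stack machines -/

section Compile

variable {ι : Type} {K : ℕ}

/-- Code size of a program (number of machine instructions). [Nipkow–Klein 2014, §8.2] [folklore] -/
def size : Com ι → ℕ
  | push _ _ => 1
  | pop _ ct cf cn => ct.size + cf.size + cn.size + 4
  | seq c₁ c₂ => c₁.size + c₂.size
  | skip => 0
  | loop _ ct cf => ct.size + cf.size + 3
  | halt => 1

/-- **The compiler.** `code c base fin`: machine code for `c` to be placed at address `base`;
control leaves it at `base + |c|`; `halt` jumps to `fin`. Layouts: `pop k ct cf cn` ↦
`pop k · · ·, ⟦ct⟧, goto exit, ⟦cf⟧, goto exit, ⟦cn⟧, goto exit`; `loop k ct cf` ↦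
`pop k · · exit, ⟦ct⟧, goto base, ⟦cf⟧, goto base`. [Nipkow–Klein 2014, §8.2 (compilation of
WHILE)] [folklore] -/
def code : Com (Fin K) → ℕ → ℕ → SProg K
  | push k b, _, _ => [SInstr.push k b]
  | pop k ct cf cn, base, fin =>
    let aF := base + 2 + ct.size
    let aN := base + 3 + ct.size + cf.size
    let exit := base + 4 + ct.size + cf.size + cn.size
    SInstr.pop k (base + 1) aF aN :: code ct (base + 1) fin ++ SInstr.goto exit ::
      (code cf aF fin ++ SInstr.goto exit :: (code cn aN fin ++ [SInstr.goto exit]))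
  | seq c₁ c₂, base, fin => code c₁ base fin ++ code c₂ (base + c₁.size) fin
  | skip, _, _ => []
  | loop k ct cf, base, fin =>
    let aF := base + 2 + ct.size
    let exit := base + 3 + ct.size + cf.size
    SInstr.pop k (base + 1) aF exit :: code ct (base + 1) fin ++ SInstr.goto base ::
      (code cf aF fin ++ [SInstr.goto base])
  | halt, _, fin => [SInstr.goto fin]

/-- The code of `c` has length `|c|`. [Nipkow–Klein 2014, §8.2] [folklore] -/
@[simp] theorem length_code : ∀ (c : Com (Fin K)) (base fin : ℕ), (code c base fin).length = c.size
  | push k b, _, _ => rfl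
  | pop k ct cf cn, base, fin => by
    simp [code, size, length_code ct, length_code cf, length_code cn]; omega
  | seq c₁ c₂, base, fin => by simp [code, size, length_code c₁, length_code c₂]
  | skip, _, _ => rfl
  | loop k ct cf, base, fin => by simp [code, size, length_code ct, length_code cf]; omega
  | halt, _, _ => rfl

/-- The whole-program compilation: code at address `0`, `halt` jumping to the end.
[Nipkow–Klein 2014, §8.2] [folklore] -/
def compile (c : Com (Fin K)) : SProg K := code c 0 c.size

/-- The compiled program has length `|c|`. [folklore] -/
@[simp] theorem length_compile (c : Com (Fin K)) : (compile c).length = c.size := length_code c 0 _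

/-! ### Placement of code inside a program -/

/-- `Placed Q base L`: the instructions `L` occupy addresses `base, base + 1, …` of `Q`.
[Nipkow–Klein 2014, §8.3 (code as a sublist of the machine program)] [folklore] -/
def Placed (Q : SProg K) (base : ℕ) (L : List (SInstr K)) : Prop :=
  ∀ i (h : i < L.length), Q[base + i]? = some L[i]

/-- Placement of a concatenation. [folklore] -/
theorem placed_append {Q : SProg K} {base : ℕ} {L₁ L₂ : List (SInstr K)} :
    Placed Q base (L₁ ++ L₂) ↔ Placed Q base L₁ ∧ Placed Q (base + L₁.length) L₂ := by
  constructor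
  · intro h
    refine ⟨fun i hi => ?_, fun i hi => ?_⟩
    · rw [h i (by simp; omega), List.getElem_append_left hi]
    · have := h (L₁.length + i) (by simp; omega)
      rw [List.getElem_append_right (by omega)] at this
      simpa [Nat.add_assoc] using this
  · rintro ⟨h₁, h₂⟩ i hi
    rw [List.length_append] at hi
    by_cases hi₁ : i < L₁.length
    · rw [h₁ i hi₁, List.getElem_append_left hi₁]
    · obtain ⟨j, rfl⟩ := Nat.exists_eq_add_of_le (Nat.le_of_not_lt hi₁)
      rw [← Nat.add_assoc, h₂ j (by omega), List.getElem_append_right (by omega)]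
      simp

/-- Placement of `x :: L`. [folklore] -/
theorem placed_cons {Q : SProg K} {base : ℕ} {x : SInstr K} {L : List (SInstr K)} :
    Placed Q base (x :: L) ↔ Q[base]? = some x ∧ Placed Q (base + 1) L := by
  rw [← List.singleton_append, placed_append]
  simp only [List.length_singleton]
  constructor
  · rintro ⟨h, h'⟩; exact ⟨by simpa using h 0 (by simp), h'⟩
  · rintro ⟨h, h'⟩; exact ⟨fun i hi => by simp at hi; subst hi; simpa using h, h'⟩

/-- A program is placed at address `0` of itself. [folklore] -/
theorem placed_self (Q : SProg K) : Placed Q 0 Q := fun i hi => by simp [hi]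

/-- Re-addressing a placement. [folklore] -/
theorem Placed.congr_base {Q : SProg K} {b b' : ℕ} {L : List (SInstr K)} (h : Placed Q b L)
    (e : b = b') : Placed Q b' L := e ▸ h

/-- The first instruction of a placed block. [folklore] -/
theorem Placed.head {Q : SProg K} {b : ℕ} {x : SInstr K} {L : List (SInstr K)}
    (h : Placed Q b (x :: L)) : Q[b]? = some x := (placed_cons.1 h).1

/-- The rest of a placed block. [folklore] -/
theorem Placed.tail {Q : SProg K} {b : ℕ} {x : SInstr K} {L : List (SInstr K)}
    (h : Placed Q b (x :: L)) : Placed Q (b + 1) L := (placed_cons.1 h).2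

/-- The left part of a placed concatenation. [folklore] -/
theorem Placed.left {Q : SProg K} {b : ℕ} {L₁ L₂ : List (SInstr K)} (h : Placed Q b (L₁ ++ L₂)) :
    Placed Q b L₁ := (placed_append.1 h).1

/-- The right part of a placed concatenation. [folklore] -/
theorem Placed.right {Q : SProg K} {b : ℕ} {L₁ L₂ : List (SInstr K)} (h : Placed Q b (L₁ ++ L₂)) :
    Placed Q (b + L₁.length) L₂ := (placed_append.1 h).2

/-- Placement inversion for `pop k ct cf cn` (addresses as reached by the execution).
[folklore] -/
theorem placed_code_pop {Q : SProg K} {base fin : ℕ} {k : Fin K} {ct cf cn : Com (Fin K)}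
    (hp : Placed Q base (code (pop k ct cf cn) base fin)) :
    Q[base]? = some (SInstr.pop k (base + 1) (base + 2 + ct.size) (base + 3 + ct.size + cf.size)) ∧
    Placed Q (base + 1) (code ct (base + 1) fin) ∧
    Q[base + 1 + ct.size]? = some (SInstr.goto (base + 4 + ct.size + cf.size + cn.size)) ∧
    Placed Q (base + 2 + ct.size) (code cf (base + 2 + ct.size) fin) ∧
    Q[base + 2 + ct.size + cf.size]? =
      some (SInstr.goto (base + 4 + ct.size + cf.size + cn.size)) ∧
    Placed Q (base + 3 + ct.size + cf.size) (code cn (base + 3 + ct.size + cf.size) fin) ∧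
    Q[base + 3 + ct.size + cf.size + cn.size]? =
      some (SInstr.goto (base + 4 + ct.size + cf.size + cn.size)) := by
  simp only [code] at hp
  have h1 : Placed Q (base + 1 + ct.size) _ := hp.right.congr_base (by simp; omega)
  have h2 : Placed Q (base + 2 + ct.size) _ := h1.tail.congr_base (by omega)
  have h3 : Placed Q (base + 2 + ct.size + cf.size) _ := h2.right.congr_base (by simp)
  have h4 : Placed Q (base + 3 + ct.size + cf.size) _ := h3.tail.congr_base (by omega)
  have h5 : Placed Q (base + 3 + ct.size + cf.size + cn.size) _ := h4.right.congr_base (by simp)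
  exact ⟨hp.left.head, hp.left.tail, h1.head, h2.left, h3.head, h4.left, h5.head⟩

/-- Placement inversion for `loop k ct cf`. [folklore] -/
theorem placed_code_loop {Q : SProg K} {base fin : ℕ} {k : Fin K} {ct cf : Com (Fin K)}
    (hp : Placed Q base (code (loop k ct cf) base fin)) :
    Q[base]? = some (SInstr.pop k (base + 1) (base + 2 + ct.size) (base + 3 + ct.size + cf.size)) ∧
    Placed Q (base + 1) (code ct (base + 1) fin) ∧
    Q[base + 1 + ct.size]? = some (SInstr.goto base) ∧
    Placed Q (base + 2 + ct.size) (code cf (base + 2 + ct.size) fin) ∧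
    Q[base + 2 + ct.size + cf.size]? = some (SInstr.goto base) := by
  simp only [code] at hp
  have h1 : Placed Q (base + 1 + ct.size) _ := hp.right.congr_base (by simp; omega)
  have h2 : Placed Q (base + 2 + ct.size) _ := h1.tail.congr_base (by omega)
  have h3 : Placed Q (base + 2 + ct.size + cf.size) _ := h2.right.congr_base (by simp)
  exact ⟨hp.left.head, hp.left.tail, h1.head, h2.left, h3.head⟩

/-- Placement inversion for `c₁ ;; c₂`. [folklore] -/
theorem placed_code_seq {Q : SProg K} {base fin : ℕ} {c₁ c₂ : Com (Fin K)}
    (hp : Placed Q base (code (c₁ ;; c₂) base fin)) :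
    Placed Q base (code c₁ base fin) ∧ Placed Q (base + c₁.size) (code c₂ (base + c₁.size) fin) := by
  simp only [code] at hp
  exact ⟨hp.left, hp.right.congr_base (by simp)⟩

/-! ### Adequacy of the cost semantics -/

/-- Padding: once the halted address `fin` is reached, later iterates stay there. [folklore] -/
theorem iterate_of_reached {Q : SProg K} {fin : ℕ} (hfin : Q.length ≤ fin) {c : SCfg K}
    {R' : Regs (Fin K)} {t t' : ℕ} (h : Q.step^[t] c = ⟨fin, R'⟩) (ht : t ≤ t') :
    Q.step^[t'] c = ⟨fin, R'⟩ := by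
  obtain ⟨d, rfl⟩ := Nat.exists_eq_add_of_le ht
  rw [Nat.add_comm, Function.iterate_add_apply, h]
  exact Q.iterate_step_of_le (c := ⟨fin, R'⟩) hfin d

/-- One machine step at an address holding a given instruction. [folklore] -/
theorem step_of_getElem? {Q : SProg K} {pc : ℕ} {ins : SInstr K} (h : Q[pc]? = some ins)
    (R : Regs (Fin K)) :
    Q.step ⟨pc, R⟩ =
      match ins with
      | .push k b => ⟨pc + 1, Function.update R k (b :: R k)⟩
      | .goto j => ⟨j, R⟩
      | .pop k jt jf jn =>
        match R k with
        | [] => ⟨jn, R⟩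
        | true :: w => ⟨jt, Function.update R k w⟩
        | false :: w => ⟨jf, Function.update R k w⟩ := by
  unfold SProg.step
  simp only [h]
  cases ins <;> rfl

/-- Configurations with equal components are equal (for closing address arithmetic). [folklore] -/
theorem cfg_eq_of {pc pc' : ℕ} {R : Regs (Fin K)} (h : pc = pc') : (⟨pc, R⟩ : SCfg K) = ⟨pc', R⟩ := by
  rw [h]

/-- **Adequacy (compiler correctness with exact step counts).** If `Exec c R s R' t` and the
code of `c` is placed at `base` in `Q` (with `halt` compiled to `goto fin`, `fin` a halted
address), then `t` steps of `Q` lead from `⟨base, R⟩` to `⟨base + |c|, R'⟩` if `s = false`,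
and to the halted configuration `⟨fin, R'⟩` if `s = true`.
[Nipkow–Klein 2014, §8.3, Lemma 8.9 / Thm. 8.10 (big-step ⇒ machine execution)] [folklore] -/
theorem Exec.iterate_step {Q : SProg K} {fin : ℕ} (hfin : Q.length ≤ fin) {c : Com (Fin K)}
    {R : Regs (Fin K)} {s : Bool} {R' : Regs (Fin K)} {t : ℕ} (h : Exec c R s R' t) :
    ∀ {base : ℕ}, Placed Q base (code c base fin) →
      Q.step^[t] ⟨base, R⟩ = if s then ⟨fin, R'⟩ else ⟨base + c.size, R'⟩ := by
  induction h with
  | push =>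
    intro base hp
    rw [code] at hp
    simp [step_of_getElem? hp.head, size]
  | @pop_true k ct cf cn R R' w s t hk h ih =>
    intro base hp
    obtain ⟨h0, hct, hg1, hcf, hg2, hcn, hg3⟩ := placed_code_pop hp
    rw [show t + 2 = (t + 1) + 1 from rfl, Function.iterate_succ_apply,
      step_of_getElem? h0]
    simp only [hk]
    rw [Function.iterate_succ_apply', ih hct]
    cases s
    · simp only [Bool.false_eq_true, ↓reduceIte]
      rw [step_of_getElem? hg1]
      exact cfg_eq_of (by simp [size]; omega)
    · simp only [↓reduceIte]
      exact Q.step_of_le hfin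
  | @pop_false k ct cf cn R R' w s t hk h ih =>
    intro base hp
    obtain ⟨h0, hct, hg1, hcf, hg2, hcn, hg3⟩ := placed_code_pop hp
    rw [show t + 2 = (t + 1) + 1 from rfl, Function.iterate_succ_apply,
      step_of_getElem? h0]
    simp only [hk]
    rw [Function.iterate_succ_apply', ih hcf]
    cases s
    · simp only [Bool.false_eq_true, ↓reduceIte]
      rw [step_of_getElem? hg2]
      exact cfg_eq_of (by simp [size]; omega)
    · simp only [↓reduceIte]
      exact Q.step_of_le hfin
  | @pop_nil k ct cf cn R R' s t hk h ih =>
    intro base hp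
    obtain ⟨h0, hct, hg1, hcf, hg2, hcn, hg3⟩ := placed_code_pop hp
    rw [show t + 2 = (t + 1) + 1 from rfl, Function.iterate_succ_apply,
      step_of_getElem? h0]
    simp only [hk]
    rw [Function.iterate_succ_apply', ih hcn]
    cases s
    · simp only [Bool.false_eq_true, ↓reduceIte]
      rw [step_of_getElem? hg3]
      exact cfg_eq_of (by simp [size]; omega)
    · simp only [↓reduceIte]
      exact Q.step_of_le hfin
  | @seq c₁ c₂ R R₁ R₂ s t₁ t₂ h₁ h₂ ih₁ ih₂ =>
    intro base hp
    obtain ⟨hp₁, hp₂⟩ := placed_code_seq hp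
    rw [Nat.add_comm t₁ t₂, Function.iterate_add_apply, ih₁ hp₁]
    simp only [Bool.false_eq_true, ↓reduceIte]
    rw [ih₂ hp₂]
    cases s
    · exact cfg_eq_of (by simp [size]; omega)
    · rfl
  | seq_stop h₁ ih₁ =>
    intro base hp
    simpa using ih₁ (placed_code_seq hp).1
  | skip => intro base hp; simp [size]
  | loop_nil hk =>
    intro base hp
    obtain ⟨h0, -, -, -, -⟩ := placed_code_loop hp
    simp only [Function.iterate_one, step_of_getElem? h0, hk, Bool.false_eq_true, ↓reduceIte]
    exact cfg_eq_of (by simp [size]; omega)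
  | @loop_true k ct cf R R₁ R₂ w s t₁ t₂ hk h₁ h₂ ih₁ ih₂ =>
    intro base hp
    obtain ⟨h0, hct, hg1, hcf, hg2⟩ := placed_code_loop hp
    rw [show t₁ + 2 + t₂ = t₂ + ((t₁ + 1) + 1) by omega, Function.iterate_add_apply,
      Function.iterate_succ_apply, step_of_getElem? h0]
    simp only [hk]
    rw [Function.iterate_succ_apply', ih₁ hct]
    simp only [Bool.false_eq_true, ↓reduceIte]
    rw [step_of_getElem? hg1]
    exact ih₂ hp
  | @loop_true_stop k ct cf R R₁ w t₁ hk h₁ ih₁ =>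
    intro base hp
    obtain ⟨h0, hct, hg1, hcf, hg2⟩ := placed_code_loop hp
    rw [show t₁ + 2 = (t₁ + 1) + 1 from rfl, Function.iterate_succ_apply, step_of_getElem? h0]
    simp only [hk]
    rw [Function.iterate_succ_apply', ih₁ hct]
    simp only [↓reduceIte]
    exact Q.step_of_le hfin
  | @loop_false k ct cf R R₁ R₂ w s t₁ t₂ hk h₁ h₂ ih₁ ih₂ =>
    intro base hp
    obtain ⟨h0, hct, hg1, hcf, hg2⟩ := placed_code_loop hp
    rw [show t₁ + 2 + t₂ = t₂ + ((t₁ + 1) + 1) by omega, Function.iterate_add_apply,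
      Function.iterate_succ_apply, step_of_getElem? h0]
    simp only [hk]
    rw [Function.iterate_succ_apply', ih₁ hcf]
    simp only [Bool.false_eq_true, ↓reduceIte]
    rw [step_of_getElem? hg2]
    exact ih₂ hp
  | @loop_false_stop k ct cf R R₁ w t₁ hk h₁ ih₁ =>
    intro base hp
    obtain ⟨h0, hct, hg1, hcf, hg2⟩ := placed_code_loop hp
    rw [show t₁ + 2 = (t₁ + 1) + 1 from rfl, Function.iterate_succ_apply, step_of_getElem? h0]
    simp only [hk]
    rw [Function.iterate_succ_apply', ih₁ hcf]
    simp only [↓reduceIte]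
    exact Q.step_of_le hfin
  | halt =>
    intro base hp
    rw [code] at hp
    simp [step_of_getElem? hp.head]

/-- **The compiled program realises the cost semantics**: an execution of cost `t` (stopped or
not) is `t` machine steps from `⟨0, R⟩` to the halted configuration `⟨|c|, R'⟩`, which all
later iterates keep. [Nipkow–Klein 2014, §8.3, Thm. 8.10] [folklore] -/
theorem Exec.compile_iterate {c : Com (Fin K)} {R : Regs (Fin K)} {s : Bool} {R' : Regs (Fin K)} {t : ℕ}
    (h : Exec c R s R' t) {t' : ℕ} (ht : t ≤ t') :
    (compile c).step^[t'] ⟨0, R⟩ = ⟨c.size, R'⟩ := by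
  have hfin : (compile c).length ≤ c.size := by simp
  have h0 := h.iterate_step hfin (base := 0) (by simpa [compile] using placed_self (compile c))
  refine iterate_of_reached hfin (t := t) ?_ ht
  rw [h0]
  cases s <;> simp

/-! ### From programs with polynomial cost to `FP` -/

/-- **Structured stack programs with polynomial cost compute `FP` functions.** If, for every
input `z`, the program `c` started on `init z` (input in the last register) executes — stopped
or not — with cost at most `T(|z|)` and leaves `f z` in register `out`, then `f ∈ FP`.
[Nipkow–Klein 2014, Ch. 8; Arora–Barak 2009, §1.3] [folklore] -/
theorem outputFn_mem_FP {K' : ℕ} (c : Com (Fin (K' + 1))) (out : Fin (K' + 1)) (T : Polynomial ℕ)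
    (f : List Bool → List Bool)
    (h : ∀ z, ∃ s R' t, Exec c (SProg.init z).regs s R' t ∧ t ≤ T.eval z.length ∧ R' out = f z) :
    f ∈ FP := by
  have hF := SProg.outputFn_mem_FP (compile c) out T
  have hfeq : (fun z => ((compile c).step^[z.length + T.eval z.length] (SProg.init z)).regs out) = f := by
    funext z
    obtain ⟨s, R', t, he, ht, hout⟩ := h z
    have := he.compile_iterate (t' := z.length + T.eval z.length) (by omega)
    rw [show (SProg.init z : SCfg (K' + 1)) = ⟨0, (SProg.init z).regs⟩ from rfl, this, ← hout]
  rwa [hfeq] at hF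

/-- **`FP` from budgeted executions.** If for every input the program runs or stops within
budget `T(|z|)` leaving `f z` in register `out`, then `f ∈ FP`. [Nipkow–Klein 2014, Ch. 8;
Arora–Barak 2009, §1.3] [folklore] -/
theorem mem_FP_of_runs {K' : ℕ} (c : Com (Fin (K' + 1))) (out : Fin (K' + 1)) (T : Polynomial ℕ)
    (f : List Bool → List Bool)
    (h : ∀ z, ∃ R', (Runs c (SProg.init z).regs R' (T.eval z.length) ∨
      Halts c (SProg.init z).regs R' (T.eval z.length)) ∧ R' out = f z) :
    f ∈ FP := by
  refine outputFn_mem_FP c out T f fun z => ?_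
  obtain ⟨R', h | h, hout⟩ := h z
  · obtain ⟨t, ht, e⟩ := h; exact ⟨false, R', t, e, ht, hout⟩
  · obtain ⟨t, ht, e⟩ := h; exact ⟨true, R', t, e, ht, hout⟩

/-- **`FP` from budgeted executions, for any finite register type.** If for every input `z`
the program `c` started on `Regs.init inp z` runs or stops within budget `T(|z|)` leaving
`f z` in register `out`, then `f ∈ FP` (rename the registers to `Fin K` with `inp` last).
[Nipkow–Klein 2014, Ch. 8; Arora–Barak 2009, §1.3] [folklore] -/
theorem mem_FP {ι : Type} [Fintype ι] [DecidableEq ι] (c : Com ι) (inp out : ι)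
    (T : Polynomial ℕ) (f : List Bool → List Bool)
    (h : ∀ z, ∃ R', (Runs c (Regs.init inp z) R' (T.eval z.length) ∨
      Halts c (Regs.init inp z) R' (T.eval z.length)) ∧ R' out = f z) :
    f ∈ FP := by
  obtain ⟨K', hK'⟩ : ∃ K', Fintype.card ι = K' + 1 :=
    Nat.exists_eq_add_one.2 (Fintype.card_pos_iff.2 ⟨inp⟩)
  let e₀ : ι ≃ Fin (K' + 1) := Fintype.equivFinOfCardEq hK'
  let e : ι ≃ Fin (K' + 1) := e₀.trans (Equiv.swap (e₀ inp) (Fin.last K'))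
  have he : e inp = Fin.last K' := by simp [e]
  have hinit : ∀ z, Regs.init inp z ∘ e.symm = (SProg.init z).regs := by
    intro z; funext k
    simp only [Function.comp_apply, Regs.init, SProg.init]
    by_cases hk : k = Fin.last K'
    · subst hk; simp [← he]
    · rw [if_neg, if_neg hk]
      intro h'
      exact hk (by rw [← he, ← h']; simp)
  refine mem_FP_of_runs (c.map e) (e out) T f fun z => ?_
  obtain ⟨R', h | h, hout⟩ := h z
  · obtain ⟨t, ht, ex⟩ := h
    refine ⟨R' ∘ e.symm, Or.inl ⟨t, ht, ?_⟩, by simpa using hout⟩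
    have := ex.map_equiv e
    rwa [hinit] at this
  · obtain ⟨t, ht, ex⟩ := h
    refine ⟨R' ∘ e.symm, Or.inr ⟨t, ht, ?_⟩, by simpa using hout⟩
    have := ex.map_equiv e
    rwa [hinit] at this

end Compile

end Com

end Literature.Computability.Complexity
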